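import Summits.RiemannHypothesis.RiemannHypothesis.Theorems.GroundBartaPolarPerronFrobeniusEvenSmallWindows
import Summits.RiemannHypothesis.RiemannHypothesis.Theorems.GroundBartaPolarPerronFrobeniusEvenSectorBridge
import Summits.RiemannHypothesis.RiemannHypothesis.Theorems.EvenSectorBartaEvenOneSignedWindowsContinuity
import HarnessLib

/-!
# RiemannHypothesis / EvenSectorBarta — crux `EvenOneSignedWindows` (stmt-RiemannHypothesis-19953):
# the SMALL-WINDOW RUNG — the matrix of the crux holds at every window `0 < a ≤ 1/4` (RH-free)

Helper file (`--supports stmt-RiemannHypothesis-19953`), RH-free, Mathlib + proved tree files only,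
no definitions, no named facts, no sorry.  Long-odds mechanism search; **no RH claim**: the crux asks for
one-signed even-sector bottom states beyond EVERY height, and this file says nothing about large windows.

The crux `EvenSectorBarta.EvenOneSignedWindows` is, definitionally, "beyond every height `A` some window
`a ≥ A` satisfies `OneSignedWindow a`" (`evenOneSignedWindows_iff_cofinal`,
Theorems/GroundBartaPolarPerronFrobeniusCruxBridge.lean; `OneSignedWindow`,
Theorems/EvenSectorBartaEvenOneSignedWindowsContinuity.lean: the window carries an even-sector bottom
state `IsWeilEvenGroundState a u` that is real and `≥ 0` a.e. on `(-a, a)`).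

This file records the bottom rung of that ladder, by composing two RH-free theorems already in the tree:

* `swe_exists_nonneg_isWeilGroundState` (Theorems/GroundBartaPolarPerronFrobeniusEvenSmallWindows.lean,
  GroundBarta seat): for `0 < a ≤ 1/4` the FULL windowed Weil form has a ground state that is real and
  `≥ 0` a.e. (even-sector sign-improving inequality — the Beurling–Deny gain of the Markov part beats the
  rank-one polar loss — plus cone minimising sequences and the Connes–Consani–Moscovici compactness);
* `exists_evenSectorOneSigned_of_oneSigned` (Theorems/GroundBartaPolarPerronFrobeniusEvenSectorBridge.lean):
  a one-signed full ground state yields a one-signed EVEN-SECTOR bottom state.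

Consequences recorded here:

* `oneSignedWindow_of_le_quarter` — **`OneSignedWindow a` for every `0 < a ≤ 1/4`**: the matrix of item
  19953 holds at every small window (the route's BC5 rung, RH-free);
* `exists_even_real_nonneg_isWeilEvenGroundState_of_le_quarter` — indeed an even-sector bottom state that
  is even, real-valued and `≥ 0` EVERYWHERE;
* `exists_oneSignedWindow_ge_of_le_quarter` — the crux's `∀ A, ∃ a ≥ A, …` clause for every height
  `A ≤ 1/4` (the crux itself needs every real `A`);
* `evenOneSignedWindows_of_continuityRoute_quarter` — the continuity route of
  Theorems/EvenSectorBartaEvenOneSignedWindowsContinuity.lean with its BASE DISCHARGED: the crux follows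
  from the two remaining analytic inputs (openness to the right of one-signedness along the window
  parameter from `a₀ = 1/4`, and closedness under limits from below), the start `OneSignedWindow (1/4)`
  being a theorem;
* `evenOneSignedWindows_of_forall_gt_quarter` — in particular the crux follows from one-signedness at
  every window `a > 1/4` (trivial bookkeeping, recorded for the ledger of what remains).

What remains RH-bearing is therefore confined to windows `a > 1/4`: beyond the pointwise kernel threshold
(`2 cosh(r/2) ≤ w(r)`, `a ≤ 0.1406…`, even-symmetrised `0.277…`; barrier file
Theorems/GroundBartaPolarPerronFrobeniusSignImprovingBarrier*.lean) the form inequality `Re Q(|g|) ≤ Re Q(g)`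
fails and one-signedness of the bottom state must come from the structure of near-minimisers — in the PF
lane's language, from the anti-maximum principle for the pole-free operator (`AntiMaximumWindowSeq`,
Theorems/EvenSectorBartaEvenOneSignedWindowsAntiMaximum.lean) holding up to the even bottom level.

PF seat `pub-rhpf-pf` gen 5 (planner-pub-rhpf-pf-g5-0).  References: E. Bombieri, Rend. Lincei (9) 11
(2000) §4; A. Connes, C. Consani, H. Moscovici, arXiv:2511.22755 Thm 3.6; M. Suzuki, arXiv:2606.09096 Thm 1.4.
-/

set_option linter.dupNamespace false

noncomputable section

open Set MeasureTheory Filter Complex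
open scoped Real Topology

namespace Summit.RiemannHypothesis.RiemannHypothesis.Theorems.PolarPerronFrobenius

open Literature.NumberTheory.LFunctions

/-- **The small-window rung of item 19953.**  Every window `0 < a ≤ 1/4` carries an even-sector bottom
state that is real and `≥ 0` a.e. on `(-a, a)`: `OneSignedWindow a`.  RH-free (sign-improving inequality
of the even sector + compactness + the full-to-even-sector bridge, all proved in the tree). [folklore] -/
theorem oneSignedWindow_of_le_quarter {a : ℝ} (ha : 0 < a) (ha' : a ≤ 1 / 4) : OneSignedWindow a := by
  obtain ⟨u, hu, hsign⟩ := swe_exists_nonneg_isWeilGroundState ha ha'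
  obtain ⟨v, hv, hvsign⟩ :=
    exists_evenSectorOneSigned_of_oneSigned hu (hsign.mono fun t ht _ => ht)
  exact ⟨v, hv, hvsign⟩

/-- **The base window of the continuity route**: `OneSignedWindow (1/4)`. [folklore] -/
theorem oneSignedWindow_quarter : OneSignedWindow (1 / 4) :=
  oneSignedWindow_of_le_quarter (by norm_num) le_rfl

/-- **An even, real-valued, everywhere non-negative EVEN-SECTOR bottom state at every window
`0 < a ≤ 1/4`.** [folklore] -/
theorem exists_even_real_nonneg_isWeilEvenGroundState_of_le_quarter {a : ℝ} (ha : 0 < a)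
    (ha' : a ≤ 1 / 4) :
    ∃ u : ℝ → ℂ, IsWeilEvenGroundState a u ∧ (∀ t, u (-t) = u t) ∧ (∀ t, (u t).im = 0) ∧
      ∀ t, 0 ≤ (u t).re := by
  obtain ⟨u, hu, hev, hre, hnn⟩ := swe_exists_even_real_nonneg_isWeilGroundState ha ha'
  exact ⟨u, isWeilEvenGroundState_of_even_groundState hu hev, hev, hre, hnn⟩

/-- **The set of one-signed windows contains `(0, 1/4]`.** [folklore] -/
theorem Ioc_quarter_subset_setOf_oneSignedWindow : Ioc (0 : ℝ) (1 / 4) ⊆ {a | OneSignedWindow a} :=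
  fun _ ha => oneSignedWindow_of_le_quarter ha.1 ha.2

/-- **The crux's cofinality clause below height `1/4`.**  For every `A ≤ 1/4` there is a window `a ≥ A`
carrying a one-signed even-sector bottom state (namely `a = 1/4`).  The crux
`EvenSectorBarta.EvenOneSignedWindows` asks this for EVERY real `A`; nothing is claimed there.
[folklore] -/
theorem exists_oneSignedWindow_ge_of_le_quarter {A : ℝ} (hA : A ≤ 1 / 4) :
    ∃ a : ℝ, A ≤ a ∧ ∃ u : ℝ → ℂ, IsWeilEvenGroundState a u ∧
      ∀ᵐ t : ℝ, t ∈ Ioo (-a) a → (u t).im = 0 ∧ 0 ≤ (u t).re :=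
  ⟨1 / 4, hA, oneSignedWindow_quarter⟩

/-- **The continuity route with its base discharged.**  If one-signedness of the even-sector bottom is
open to the right along the window parameter on `[1/4, ∞)` (`hup`) and closed under limits from below
(`hlim`), then `EvenSectorBarta.EvenOneSignedWindows` holds — the start `OneSignedWindow (1/4)` of
`evenOneSignedWindows_of_continuityRoute` is now a theorem. [folklore] -/
theorem evenOneSignedWindows_of_continuityRoute_quarter
    (hup : ∀ a, (1 / 4 : ℝ) ≤ a → OneSignedWindow a →
      ∃ δ > 0, ∀ b, a ≤ b → b < a + δ → OneSignedWindow b)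
    (hlim : ∀ a, (1 / 4 : ℝ) < a → (∀ b, (1 / 4 : ℝ) ≤ b → b < a → OneSignedWindow b) →
      OneSignedWindow a) :
    Summit.RiemannHypothesis.RiemannHypothesis.Theses.EvenSectorBarta.EvenOneSignedWindows :=
  evenOneSignedWindows_of_continuityRoute oneSignedWindow_quarter hup hlim

/-- **All windows one-signed from the two continuity inputs** (base discharged). [folklore] -/
theorem forall_oneSignedWindow_of_continuityRoute_quarter
    (hup : ∀ a, (1 / 4 : ℝ) ≤ a → OneSignedWindow a →
      ∃ δ > 0, ∀ b, a ≤ b → b < a + δ → OneSignedWindow b)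
    (hlim : ∀ a, (1 / 4 : ℝ) < a → (∀ b, (1 / 4 : ℝ) ≤ b → b < a → OneSignedWindow b) →
      OneSignedWindow a) :
    ∀ a : ℝ, 0 < a → OneSignedWindow a := by
  intro a ha
  by_cases h : a ≤ 1 / 4
  · exact oneSignedWindow_of_le_quarter ha h
  · exact forall_oneSignedWindow_of_continuityRoute oneSignedWindow_quarter hup hlim a
      (le_of_lt (not_le.mp h))

/-- **What remains is confined to windows `a > 1/4`** (bookkeeping): one-signed even-sector bottom states
at every window `a > 1/4` — indeed at any cofinal family of them — give the crux. [folklore] -/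
theorem evenOneSignedWindows_of_forall_gt_quarter
    (h : ∀ a : ℝ, 1 / 4 < a → OneSignedWindow a) :
    Summit.RiemannHypothesis.RiemannHypothesis.Theses.EvenSectorBarta.EvenOneSignedWindows := by
  refine evenOneSignedWindows_iff_cofinal.2 fun A => ?_
  refine ⟨max A 1, le_max_left _ _, ?_⟩
  have h1 : (1 / 4 : ℝ) < max A 1 := lt_of_lt_of_le (by norm_num) (le_max_right _ _)
  obtain ⟨u, hu, hsign⟩ := h (max A 1) h1
  exact ⟨u, hu, hsign⟩

/-- **Every window is one-signed, given one-signedness above `1/4`** (bookkeeping). [folklore] -/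
theorem forall_oneSignedWindow_of_forall_gt_quarter (h : ∀ a : ℝ, 1 / 4 < a → OneSignedWindow a) :
    ∀ a : ℝ, 0 < a → OneSignedWindow a := by
  intro a ha
  by_cases h' : a ≤ 1 / 4
  · exact oneSignedWindow_of_le_quarter ha h'
  · exact h a (not_le.mp h')

end Summit.RiemannHypothesis.RiemannHypothesis.Theorems.PolarPerronFrobenius

end
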